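import Mathlib
import Literature.NumberTheory.EllipticCurves.ThreeIsogeny
import Literature.NumberTheory.EllipticCurves.MordellCurvePhiDescentHom

/-!
# Rank-2 observatory — KERNEL-3ISO A5: the `3`-descent torsors and local kills (E-side)

HONEST FRAMING: per-curve certified theorems and census instruments; no claim on BSD in rank ≥ 2.

For `E = E_{m,s} : y² = x³ + (mx + s)²` (`m, s ∈ ℤ`) and `u ∈ ℤ ∖ {0}`, the class `[u] ∈ ℚˣ/ℚˣ³`
lies in the image of the `3`-descent map `α` only if the projective cubic
`F_u(X, Y, Z) = u² X³ + Y³ + 2su Z³ − 2mu XYZ = 0` (= `u · (u X³ + u⁻¹ Y³ + 2s Z³ − 2m XYZ)`)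
has a rational point [cite: CohenPazuki2009, Thm. 3.1 (1)–(2); Cohen2007NumberTheoryI, Prop. 8.4.8]:
`α(P) = u z³` at `P = (x, y)` gives the point `(z², −x, z)` (`torsor_of_descent`), the class of
`T` the point `(0, −2s, w)` and the trivial class `(1, −c², 0)`.

A rational point gives, after scaling by the coordinate of largest `p`-adic norm, a `ℤ_p`-point with a
coordinate equal to `1`, hence a solution modulo `p^k` with a coordinate `1`
(`exists_zmod_solution`). The contrapositive `descent_value_ne_of_kill` is the LOCAL KILL used by
the per-curve certificates: a `decide`d exhaustion over `ZMod (p^k)` showing no normalised solution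
removes `[u]` from the candidate set `S₁`. All statements are def-free.
-/

set_option linter.dupNamespace false

noncomputable section

open scoped Classical

open WeierstrassCurve

namespace Summit.BirchSwinnertonDyer.BirchSwinnertonDyer.Rank2Observatory.ThreeIso

open Literature.NumberTheory.EllipticCurves Literature.NumberTheory.EllipticCurves.MordellDescent

/-! ### Rational points on the torsor from points of `E` -/

/-- [cite: CohenPazuki2009, Thm. 3.1 (2)] `α(P) = u z³` at `P = (x, y)` gives the point `(z², -x, z)`
of `u²X³ + Y³ + 2suZ³ - 2muXYZ = 0`. -/
theorem torsor_of_descent {F : Type*} [Field F] {m s u x y z : F}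
    (hE : y ^ 2 = x ^ 3 + (m * x + s) ^ 2) (hδ : y - (m * x + s) = u * z ^ 3) :
    u ^ 2 * (z ^ 2) ^ 3 + (-x) ^ 3 + 2 * s * u * z ^ 3 - 2 * m * u * (z ^ 2 * (-x) * z) = 0 := by
  have hδ' : u * z ^ 3 = y - (m * x + s) := hδ.symm
  linear_combination hE + (u * z ^ 3 + m * x + s + y) * hδ'

/-- The class of `T`: `(2s)² = u w³` gives the point `(0, -2s, w)`. -/
theorem torsor_of_T {F : Type*} [Field F] {s u w : F} (m : F) (h : (2 * s) ^ 2 = u * w ^ 3) :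
    u ^ 2 * (0 : F) ^ 3 + (-(2 * s)) ^ 3 + 2 * s * u * w ^ 3 - 2 * m * u * (0 * (-(2 * s)) * w) = 0 := by
  linear_combination (-(2 * s)) * h

/-- The trivial class: `1 = u c³` gives the point `(c², -1, 0)`. -/
theorem torsor_of_one {F : Type*} [Field F] {u c : F} (m s : F) (h : (1 : F) = u * c ^ 3) :
    u ^ 2 * (c ^ 2) ^ 3 + (-1 : F) ^ 3 + 2 * s * u * (0 : F) ^ 3 - 2 * m * u * (c ^ 2 * (-1) * 0) = 0 := by
  linear_combination (u * c ^ 3 + 1) * h.symm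

/-! ### From a rational point to a normalised solution modulo `p^k` -/

section Padic

variable {p : ℕ} [Fact p.Prime]

/-- Scaling a `ℚ_p`-point of a cubic `A X³ + B Y³ + C Z³ + D XYZ = 0` (`A, B, C, D ∈ ℤ`) by a
coordinate `t ≠ 0` dominating all three in norm gives a `ℤ_p`-point, and reduction modulo `p^k` a
solution with the `t`-coordinate equal to `1`. -/
theorem exists_zmod_solution_of_padic (k : ℕ) {A B C D : ℤ} {X Y Z : ℚ_[p]}
    (hne : X ≠ 0 ∨ Y ≠ 0 ∨ Z ≠ 0)
    (hF : (A : ℚ_[p]) * X ^ 3 + B * Y ^ 3 + C * Z ^ 3 + D * (X * Y * Z) = 0) :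
    ∃ a b c : ZMod (p ^ k), (a = 1 ∨ b = 1 ∨ c = 1) ∧
      (A : ZMod (p ^ k)) * a ^ 3 + B * b ^ 3 + C * c ^ 3 + D * (a * b * c) = 0 := by
  -- a dominating coordinate `t`
  obtain ⟨t, ht0, htX, htY, htZ, ht⟩ : ∃ t : ℚ_[p], t ≠ 0 ∧ ‖X‖ ≤ ‖t‖ ∧ ‖Y‖ ≤ ‖t‖ ∧ ‖Z‖ ≤ ‖t‖ ∧
      (t = X ∨ t = Y ∨ t = Z) := by
    by_cases h1 : ‖Y‖ ≤ ‖X‖ ∧ ‖Z‖ ≤ ‖X‖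
    · refine ⟨X, ?_, le_rfl, h1.1, h1.2, Or.inl rfl⟩
      rintro rfl
      rcases hne with h | h | h
      · exact h rfl
      · exact h (norm_le_zero_iff.mp (by simpa using h1.1))
      · exact h (norm_le_zero_iff.mp (by simpa using h1.2))
    by_cases h2 : ‖X‖ ≤ ‖Y‖ ∧ ‖Z‖ ≤ ‖Y‖
    · refine ⟨Y, ?_, h2.1, le_rfl, h2.2, Or.inr (Or.inl rfl)⟩
      rintro rfl
      rcases hne with h | h | h
      · exact h (norm_le_zero_iff.mp (by simpa using h2.1))
      · exact h rfl
      · exact h (norm_le_zero_iff.mp (by simpa using h2.2))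
    · have hXZ : ‖X‖ ≤ ‖Z‖ := by
        rw [not_and_or, not_le, not_le] at h1 h2
        rcases h1 with h1 | h1
        · rcases h2 with h2 | h2
          · exact absurd (h1.trans h2) (lt_irrefl _)
          · exact (h1.trans h2).le
        · exact h1.le
      have hYZ : ‖Y‖ ≤ ‖Z‖ := by
        rw [not_and_or, not_le, not_le] at h1 h2
        rcases h2 with h2 | h2
        · rcases h1 with h1 | h1
          · exact absurd (h1.trans h2) (lt_irrefl _)
          · exact (h2.trans h1).le
        · exact h2.le
      refine ⟨Z, ?_, hXZ, hYZ, le_rfl, Or.inr (Or.inr rfl)⟩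
      rintro rfl
      rcases hne with h | h | h
      · exact h (norm_le_zero_iff.mp (by simpa using hXZ))
      · exact h (norm_le_zero_iff.mp (by simpa using hYZ))
      · exact h rfl
  have htn : 0 < ‖t‖ := norm_pos_iff.mpr ht0
  have hle : ∀ {V : ℚ_[p]}, ‖V‖ ≤ ‖t‖ → ‖V / t‖ ≤ 1 := fun hV => by
    rw [norm_div, div_le_one htn]; exact hV
  -- the scaled `ℤ_p`-point
  set a₀ : ℤ_[p] := ⟨X / t, hle htX⟩ with ha₀
  set b₀ : ℤ_[p] := ⟨Y / t, hle htY⟩ with hb₀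
  set c₀ : ℤ_[p] := ⟨Z / t, hle htZ⟩ with hc₀
  have hF' : (A : ℚ_[p]) * (X / t) ^ 3 + B * (Y / t) ^ 3 + C * (Z / t) ^ 3
      + D * (X / t * (Y / t) * (Z / t)) = 0 := by
    field_simp
    linear_combination hF
  have hF₀ : (A : ℤ_[p]) * a₀ ^ 3 + B * b₀ ^ 3 + C * c₀ ^ 3 + D * (a₀ * b₀ * c₀) = 0 := by
    apply PadicInt.ext
    rw [PadicInt.coe_add, PadicInt.coe_add, PadicInt.coe_add, PadicInt.coe_mul, PadicInt.coe_mul,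
      PadicInt.coe_mul, PadicInt.coe_mul, PadicInt.coe_mul, PadicInt.coe_mul, PadicInt.coe_pow,
      PadicInt.coe_pow, PadicInt.coe_pow, PadicInt.coe_intCast, PadicInt.coe_intCast,
      PadicInt.coe_intCast, PadicInt.coe_intCast, PadicInt.coe_zero]
    exact hF'
  have h1 : ∀ {V : ℚ_[p]} (hV : ‖V / t‖ ≤ 1), t = V →
      PadicInt.toZModPow k (⟨V / t, hV⟩ : ℤ_[p]) = 1 := by
    intro V hV htV
    have : (⟨V / t, hV⟩ : ℤ_[p]) = (1 : ℤ_[p]) := by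
      apply PadicInt.ext
      show V / t = ((1 : ℤ_[p]) : ℚ_[p])
      rw [PadicInt.coe_one, ← htV]
      exact div_self ht0
    rw [this, map_one]
  refine ⟨PadicInt.toZModPow k a₀, PadicInt.toZModPow k b₀, PadicInt.toZModPow k c₀, ?_, ?_⟩
  · rcases ht with h | h | h
    · exact Or.inl (h1 _ h)
    · exact Or.inr (Or.inl (h1 _ h))
    · exact Or.inr (Or.inr (h1 _ h))
  · have := congrArg (PadicInt.toZModPow k) hF₀
    rwa [map_add, map_add, map_add, map_mul, map_mul, map_mul, map_mul, map_mul, map_mul, map_pow,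
      map_pow, map_pow, map_intCast, map_intCast, map_intCast, map_intCast, map_zero] at this

/-- A rational point of a cubic `A X³ + B Y³ + C Z³ + D XYZ = 0` (`A, B, C, D ∈ ℤ`) with some
coordinate non-zero gives a solution modulo `p^k` with a coordinate equal to `1`. -/
theorem exists_zmod_solution (k : ℕ) {A B C D : ℤ} {X Y Z : ℚ} (hne : X ≠ 0 ∨ Y ≠ 0 ∨ Z ≠ 0)
    (hF : (A : ℚ) * X ^ 3 + B * Y ^ 3 + C * Z ^ 3 + D * (X * Y * Z) = 0) :
    ∃ a b c : ZMod (p ^ k), (a = 1 ∨ b = 1 ∨ c = 1) ∧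
      (A : ZMod (p ^ k)) * a ^ 3 + B * b ^ 3 + C * c ^ 3 + D * (a * b * c) = 0 := by
  refine exists_zmod_solution_of_padic k (X := (X : ℚ_[p])) (Y := (Y : ℚ_[p])) (Z := (Z : ℚ_[p]))
    ?_ ?_
  · rcases hne with h | h | h
    · exact Or.inl (by exact_mod_cast h)
    · exact Or.inr (Or.inl (by exact_mod_cast h))
    · exact Or.inr (Or.inr (by exact_mod_cast h))
  · have := congrArg (Rat.cast : ℚ → ℚ_[p]) hF
    push_cast at this
    exact this

end Padic

/-! ### The local kill -/

/-- **Local kill** [cite: CohenPazuki2009, Thm. 3.1; Cohen2007NumberTheoryI, Prop. 8.4.8]. On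
`E_{m,s}` (`m, s ∈ ℤ`) with a `3`-descent homomorphism `κ` (values as in
`ThreeIsoDescent.exists_threeDescentHom`) and `u ∈ ℤ ∖ {0}`: let
`A X³ + B Y³ + C Z³ + D XYZ` (`A, B, C, D ∈ ℤ`) be any rescaling
`c · F_u(l₁ X, l₂ Y, l₃ Z)` of the torsor cubic `F_u = u² X³ + Y³ + 2su Z³ − 2mu XYZ`
(`c ∈ ℚ`, `lᵢ ∈ ℚˣ`; this covers the `p`-minimised models). If for some prime power `p^k` the rescaled cubic
has no zero in `ZMod (p^k)` with a coordinate equal to `1` — three finite, `decide`-able families —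
then `[u]` is not a value of `κ`. -/
theorem descent_value_ne_of_kill {W W' : WeierstrassCurve ℚ} {m s : ℤ}
    (h : IsVeluThreePair (m : ℚ) (s : ℚ) W W')
    (κ : W.toAffine.Point →+ Additive (CubeUnits ℚ))
    (hκ : ∀ (x y : ℚ) (hP : W.toAffine.Nonsingular x y), κ (.some x y hP) =
      Additive.ofMul (cubeClass (if y = m * x + s then (2 * (s : ℚ)) ^ 2 else y - (m * x + s))))
    {u : ℤ} (hu : u ≠ 0) {A B C D : ℤ} {c l₁ l₂ l₃ : ℚ} (hl₁ : l₁ ≠ 0) (hl₂ : l₂ ≠ 0)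
    (hl₃ : l₃ ≠ 0) (hA : (A : ℚ) = c * (u ^ 2 * l₁ ^ 3)) (hB : (B : ℚ) = c * l₂ ^ 3)
    (hC : (C : ℚ) = c * (2 * s * u * l₃ ^ 3)) (hD : (D : ℚ) = -(c * (2 * m * u * (l₁ * l₂ * l₃))))
    {p : ℕ} [Fact p.Prime] {k : ℕ}
    (hkill₁ : ∀ b c : ZMod (p ^ k),
      (A : ZMod (p ^ k)) * 1 ^ 3 + B * b ^ 3 + C * c ^ 3 + D * (1 * b * c) ≠ 0)
    (hkill₂ : ∀ a c : ZMod (p ^ k),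
      (A : ZMod (p ^ k)) * a ^ 3 + B * 1 ^ 3 + C * c ^ 3 + D * (a * 1 * c) ≠ 0)
    (hkill₃ : ∀ a b : ZMod (p ^ k),
      (A : ZMod (p ^ k)) * a ^ 3 + B * b ^ 3 + C * 1 ^ 3 + D * (a * b * 1) ≠ 0)
    (P : W.toAffine.Point) : κ P ≠ Additive.ofMul (cubeClass (u : ℚ)) := by
  intro hP
  have hu' : (u : ℚ) ≠ 0 := by exact_mod_cast hu
  -- a rational point on the torsor `F_u = 0`, with a non-zero coordinate
  obtain ⟨X, Y, Z, hne, hF⟩ : ∃ X Y Z : ℚ, (X ≠ 0 ∨ Y ≠ 0 ∨ Z ≠ 0) ∧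
      (u : ℚ) ^ 2 * X ^ 3 + Y ^ 3 + 2 * s * u * Z ^ 3 - 2 * m * u * (X * Y * Z) = 0 := by
    rcases P with _ | ⟨x, y, hxy⟩
    · -- `κ 0 = [1] = [u]`
      rw [← Affine.Point.zero_def, map_zero] at hP
      have h1 : cubeClass (1 : ℚ) = cubeClass (u : ℚ) := by
        rw [cubeClass_one]; exact ofMul_eq_zero.mp hP.symm |>.symm
      obtain ⟨c, hc0, hc⟩ := (cubeClass_eq_cubeClass_iff one_ne_zero hu').mp h1
      exact ⟨c ^ 2, -1, 0, Or.inr (Or.inl (by norm_num)), by linear_combination torsor_of_one (m : ℚ) (s : ℚ) hc⟩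
    · rw [hκ] at hP
      have hcl := Additive.ofMul.injective hP
      have hE : y ^ 2 = x ^ 3 + (m * x + s) ^ 2 := by
        have := (h.equation_iff x y).mp hxy.left; linear_combination this
      by_cases hy : y = m * x + s
      · rw [if_pos hy] at hcl
        have h4 : (2 * (s : ℚ)) ^ 2 ≠ 0 := pow_ne_zero 2 (mul_ne_zero two_ne_zero h.s_ne)
        obtain ⟨w, hw0, hw⟩ := (cubeClass_eq_cubeClass_iff h4 hu').mp hcl
        exact ⟨0, -(2 * s), w, Or.inr (Or.inr hw0), by linear_combination torsor_of_T (m : ℚ) hw⟩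
      · rw [if_neg hy] at hcl
        obtain ⟨z, hz0, hz⟩ := (cubeClass_eq_cubeClass_iff (sub_ne_zero.mpr hy) hu').mp hcl
        exact ⟨z ^ 2, -x, z, Or.inr (Or.inr hz0), by linear_combination torsor_of_descent hE hz⟩
  -- the rescaled point on `A X³ + B Y³ + C Z³ + D XYZ = 0`
  have hF' : (A : ℚ) * (X / l₁) ^ 3 + B * (Y / l₂) ^ 3 + C * (Z / l₃) ^ 3
      + D * (X / l₁ * (Y / l₂) * (Z / l₃)) = 0 := by
    rw [hA, hB, hC, hD]
    field_simp
    linear_combination c * hF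
  have hne' : X / l₁ ≠ 0 ∨ Y / l₂ ≠ 0 ∨ Z / l₃ ≠ 0 := by
    rcases hne with h0 | h0 | h0
    · exact Or.inl (div_ne_zero h0 hl₁)
    · exact Or.inr (Or.inl (div_ne_zero h0 hl₂))
    · exact Or.inr (Or.inr (div_ne_zero h0 hl₃))
  obtain ⟨a, b, c, h1, habc⟩ := exists_zmod_solution (p := p) k hne' hF'
  rcases h1 with rfl | rfl | rfl
  · exact hkill₁ b c habc
  · exact hkill₂ a c habc
  · exact hkill₃ a b habc

end Summit.BirchSwinnertonDyer.BirchSwinnertonDyer.Rank2Observatory.ThreeIso
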